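import Mathlib
import Literature.Analysis.FluidPDE.KNSSMildDecayHorizontal
import Summits.NavierStokesRegularity.NavierStokesRegularity.Theorems.SlicedKelvinPlanarFluxAPrioriDecayKernelWeights

/-!
# Crux `SlicedKelvin.PlanarFluxAPriori` (stmt-NavierStokesRegularity-15600), line `registered`,
# stub `stub_decayPersistence` — one weighted Duhamel term against a monotone majorant

Support file (theorems only) for the weighted bootstrap of the decay-persistence stub
(Brandolese 2004; Kukavica–Torres 2006). With the truncated cubic weights
`w_R(y) = (min (1 + |y|) R)³` of `…DecayKernelWeights`:

* `decay_weighted_oseenDuhamel_le_lintegral` — if `w_R(y)|a(σ,y)||b(σ,y)| ≤ L φ(σ)` on `(0, τ)`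
  then `w_R(x) |B^ν_0(a,b)(τ)(x)| ≤ C₀ C_K L ∫_{(0,τ)} φ(σ)((ν(τ-σ))^{-1/2} + 1) dσ` (kernel bound
  (3.8) and the weighted majorant estimate; no measurability is needed);
* `decay_volterra_split` — for `φ ≥ 0` monotone and a step `δ > 0`,
  `∫_{(0,τ)} φ(σ)((ν(τ-σ))^{-1/2} + 1) dσ ≤ φ(τ)(2ν^{-1/2}√δ + δ) + φ(τ-δ)((νδ)^{-1/2} + 1)τ`;
* `decay_weighted_oseenDuhamel_le` — the two combined, in real form.

## References

* L. Brandolese, *Space-time decay of Navier–Stokes flows invariant under rotations*,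
  Math. Ann. 329 (2004) = arXiv:math/0403136.
* I. Kukavica, J. J. Torres, *Weighted bounds for the velocity and the vorticity for the
  Navier–Stokes equations*, Nonlinearity 19 (2006).
* G. Koch, N. Nadirashvili, G. Seregin, V. Šverák, Acta Math. 203 (2009), §3 (3.8), §4.
-/

noncomputable section

-- the summit and its single sub-problem share the name (CONVENTIONS §1), as in every Theorems file
set_option linter.dupNamespace false

namespace Summit.NavierStokesRegularity.NavierStokesRegularity.Theorems.SlicedKelvinPlanarFluxAPriori

open MeasureTheory Set Filter Topology Metric Real
open scoped ENNReal NNReal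
open Literature.Analysis.FluidPDE Literature.Analysis.UnboundedOperators

/-! ### The weighted Duhamel term against a monotone majorant -/

/-- **Weighted bound of one Duhamel term.** Let `K` obey the Oseen bound
`‖K(σ, z)[a, b]‖ ≤ C₀ (σ + |z|²)^{-2} |a| |b|` and let the truncated weight `w_R` be carried by
the majorant with constant `C_K` (`decay_lintegral_oseenWeight_le`). If on `(0, τ)` the fields
satisfy `w_R(y) |a(σ,y)| |b(σ,y)| ≤ L φ(σ)`, then
`w_R(x) ‖B^ν_0(a, b)(τ)(x)‖ ≤ C₀ C_K L ∫_{(0,τ)} φ(σ) ((ν(τ-σ))^{-1/2} + 1) dσ`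
(as an `ℝ≥0∞` bound; no measurability is needed). -/
theorem decay_weighted_oseenDuhamel_le_lintegral {C₀ C_K : ℝ} (hC₀ : 0 < C₀) (hC_K : 0 < C_K)
    (hK : ∀ ⦃σ : ℝ⦄, 0 < σ → ∀ z a b : EuclideanSpace ℝ (Fin 3),
      ‖oseenKernel σ z a b‖ ≤ C₀ * (σ + ‖z‖ ^ 2) ^ (-(2 : ℝ)) * ‖a‖ * ‖b‖)
    (hW : ∀ ⦃R : ℝ⦄, 1 ≤ R → ∀ ⦃s : ℝ⦄, 0 < s → ∀ x : EuclideanSpace ℝ (Fin 3),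
      ∫⁻ y, ENNReal.ofReal ((s + ‖x - y‖ ^ 2) ^ (-(2 : ℝ)) *
          ((min (1 + ‖x‖) R) ^ 3 / (min (1 + ‖y‖) R) ^ 3)) ≤
        ENNReal.ofReal (C_K * (s ^ (-(1 / 2 : ℝ)) + 1)))
    {ν : ℝ} (hν : 0 < ν) {R : ℝ} (hR : 1 ≤ R)
    {a b : ℝ → EuclideanSpace ℝ (Fin 3) → EuclideanSpace ℝ (Fin 3)} {τ L : ℝ} (hL : 0 ≤ L)
    (φ : ℝ → ℝ) (hφ0 : ∀ σ, 0 ≤ φ σ)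
    (hab : ∀ σ ∈ Ioo 0 τ, ∀ y, (min (1 + ‖y‖) R) ^ 3 * (‖a σ y‖ * ‖b σ y‖) ≤ L * φ σ)
    (x : EuclideanSpace ℝ (Fin 3)) :
    ENNReal.ofReal ((min (1 + ‖x‖) R) ^ 3) * ‖oseenDuhamel ν 0 a b τ x‖ₑ ≤
      ENNReal.ofReal (C₀ * C_K * L) *
        ∫⁻ σ in Ioo 0 τ, ENNReal.ofReal (φ σ * ((ν * (τ - σ)) ^ (-(1 / 2 : ℝ)) + 1)) := by
  set w : EuclideanSpace ℝ (Fin 3) → ℝ := fun y => (min (1 + ‖y‖) R) ^ 3 with hw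
  have hw1 : ∀ y, 1 ≤ w y := fun y => decay_one_le_weight hR y
  have hw0 : ∀ y, 0 < w y := fun y => lt_of_lt_of_le one_pos (hw1 y)
  -- pointwise bound of the weighted integrand
  have hpt : ∀ σ ∈ Ioo 0 τ, ∀ y,
      ENNReal.ofReal (w x) * ‖oseenKernel (ν * (τ - σ)) (x - y) (a σ y) (b σ y)‖ₑ ≤
        ENNReal.ofReal (C₀ * L * φ σ) *
          ENNReal.ofReal ((ν * (τ - σ) + ‖x - y‖ ^ 2) ^ (-(2 : ℝ)) * (w x / w y)) := by
    intro σ hσ y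
    have hs : 0 < ν * (τ - σ) := mul_pos hν (sub_pos.2 hσ.2)
    have hk0 : 0 ≤ (ν * (τ - σ) + ‖x - y‖ ^ 2) ^ (-(2 : ℝ)) := Real.rpow_nonneg (by positivity) _
    have hc0 : 0 ≤ C₀ * L * φ σ := mul_nonneg (mul_nonneg hC₀.le hL) (hφ0 σ)
    rw [← ofReal_norm, ← ENNReal.ofReal_mul (hw0 x).le, ← ENNReal.ofReal_mul hc0]
    refine ENNReal.ofReal_le_ofReal ?_
    have h1 := hK hs (x - y) (a σ y) (b σ y)
    have h2 := hab σ hσ y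
    have h3 : w x * (‖a σ y‖ * ‖b σ y‖) ≤ w x / w y * (L * φ σ) := by
      rw [div_mul_eq_mul_div, le_div_iff₀ (hw0 y)]
      calc w x * (‖a σ y‖ * ‖b σ y‖) * w y = w x * (w y * (‖a σ y‖ * ‖b σ y‖)) := by ring
        _ ≤ w x * (L * φ σ) := mul_le_mul_of_nonneg_left h2 (hw0 x).le
    calc w x * ‖oseenKernel (ν * (τ - σ)) (x - y) (a σ y) (b σ y)‖
        ≤ w x * (C₀ * (ν * (τ - σ) + ‖x - y‖ ^ 2) ^ (-(2 : ℝ)) * ‖a σ y‖ * ‖b σ y‖) :=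
          mul_le_mul_of_nonneg_left h1 (hw0 x).le
      _ = C₀ * (ν * (τ - σ) + ‖x - y‖ ^ 2) ^ (-(2 : ℝ)) * (w x * (‖a σ y‖ * ‖b σ y‖)) := by ring
      _ ≤ C₀ * (ν * (τ - σ) + ‖x - y‖ ^ 2) ^ (-(2 : ℝ)) * (w x / w y * (L * φ σ)) :=
          mul_le_mul_of_nonneg_left h3 (by positivity)
      _ = C₀ * L * φ σ * ((ν * (τ - σ) + ‖x - y‖ ^ 2) ^ (-(2 : ℝ)) * (w x / w y)) := by ring
  -- the slice integrals
  have hslice : ∀ σ ∈ Ioo 0 τ,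
      ENNReal.ofReal (w x) * ∫⁻ y, ‖oseenKernel (ν * (τ - σ)) (x - y) (a σ y) (b σ y)‖ₑ ≤
        ENNReal.ofReal (C₀ * C_K * L) *
          ENNReal.ofReal (φ σ * ((ν * (τ - σ)) ^ (-(1 / 2 : ℝ)) + 1)) := by
    intro σ hσ
    have hs : 0 < ν * (τ - σ) := mul_pos hν (sub_pos.2 hσ.2)
    have hks : 0 ≤ (ν * (τ - σ)) ^ (-(1 / 2 : ℝ)) + 1 := by positivity
    rw [← lintegral_const_mul' _ _ ENNReal.ofReal_ne_top]
    calc ∫⁻ y, ENNReal.ofReal (w x) * ‖oseenKernel (ν * (τ - σ)) (x - y) (a σ y) (b σ y)‖ₑ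
        ≤ ∫⁻ y, ENNReal.ofReal (C₀ * L * φ σ) *
            ENNReal.ofReal ((ν * (τ - σ) + ‖x - y‖ ^ 2) ^ (-(2 : ℝ)) * (w x / w y)) :=
          lintegral_mono (hpt σ hσ)
      _ = ENNReal.ofReal (C₀ * L * φ σ) *
            ∫⁻ y, ENNReal.ofReal ((ν * (τ - σ) + ‖x - y‖ ^ 2) ^ (-(2 : ℝ)) * (w x / w y)) :=
          lintegral_const_mul' _ _ ENNReal.ofReal_ne_top
      _ ≤ ENNReal.ofReal (C₀ * L * φ σ) *
            ENNReal.ofReal (C_K * ((ν * (τ - σ)) ^ (-(1 / 2 : ℝ)) + 1)) :=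
          mul_le_mul_right (hW hR hs x) _
      _ = ENNReal.ofReal (C₀ * C_K * L) *
            ENNReal.ofReal (φ σ * ((ν * (τ - σ)) ^ (-(1 / 2 : ℝ)) + 1)) := by
          have h1 : 0 ≤ C₀ * L * φ σ := mul_nonneg (mul_nonneg hC₀.le hL) (hφ0 σ)
          have h2 : 0 ≤ C₀ * C_K * L := by positivity
          rw [← ENNReal.ofReal_mul h1, ← ENNReal.ofReal_mul h2]
          congr 1; ring
  -- integrate in time
  calc ENNReal.ofReal (w x) * ‖oseenDuhamel ν 0 a b τ x‖ₑ
      ≤ ENNReal.ofReal (w x) *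
          ∫⁻ σ in Ioo 0 τ, ‖∫ y, oseenKernel (ν * (τ - σ)) (x - y) (a σ y) (b σ y)‖ₑ := by
        rw [oseenDuhamel_apply]
        exact mul_le_mul_right (enorm_integral_le_lintegral_enorm _) _
    _ ≤ ENNReal.ofReal (w x) *
          ∫⁻ σ in Ioo 0 τ, ∫⁻ y, ‖oseenKernel (ν * (τ - σ)) (x - y) (a σ y) (b σ y)‖ₑ :=
        mul_le_mul_right (lintegral_mono fun σ => enorm_integral_le_lintegral_enorm _) _
    _ = ∫⁻ σ in Ioo 0 τ, ENNReal.ofReal (w x) *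
          ∫⁻ y, ‖oseenKernel (ν * (τ - σ)) (x - y) (a σ y) (b σ y)‖ₑ :=
        (lintegral_const_mul' _ _ ENNReal.ofReal_ne_top).symm
    _ ≤ ∫⁻ σ in Ioo 0 τ, ENNReal.ofReal (C₀ * C_K * L) *
          ENNReal.ofReal (φ σ * ((ν * (τ - σ)) ^ (-(1 / 2 : ℝ)) + 1)) :=
        setLIntegral_mono' measurableSet_Ioo fun σ hσ => hslice σ hσ
    _ = ENNReal.ofReal (C₀ * C_K * L) *
          ∫⁻ σ in Ioo 0 τ, ENNReal.ofReal (φ σ * ((ν * (τ - σ)) ^ (-(1 / 2 : ℝ)) + 1)) :=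
        lintegral_const_mul' _ _ ENNReal.ofReal_ne_top

/-- **The Volterra integral of a monotone majorant, split at `τ - δ`.** For `φ ≥ 0` monotone,
`ν, δ > 0`:
`∫_{(0,τ)} φ(σ)((ν(τ-σ))^{-1/2} + 1) dσ ≤ φ(τ)(2ν^{-1/2}√δ + δ) + φ(τ-δ)((νδ)^{-1/2} + 1) τ`
(on `(τ-δ, τ)` bound `φ ≤ φ(τ)` and integrate the kernel; on `(0, τ-δ]` bound `φ ≤ φ(τ-δ)`
and the kernel by its value at distance `δ`; for `τ ≤ 0` the left side vanishes). -/
theorem decay_volterra_split {ν : ℝ} (hν : 0 < ν) (φ : ℝ → ℝ) (hφ0 : ∀ σ, 0 ≤ φ σ)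
    (hφm : Monotone φ) {δ : ℝ} (hδ : 0 < δ) {τ : ℝ} (hτ : 0 ≤ τ) :
    ∫⁻ σ in Ioo 0 τ, ENNReal.ofReal (φ σ * ((ν * (τ - σ)) ^ (-(1 / 2 : ℝ)) + 1)) ≤
      ENNReal.ofReal (φ τ * (2 * ν ^ (-(1 / 2 : ℝ)) * Real.sqrt δ + δ) +
        φ (τ - δ) * ((ν * δ) ^ (-(1 / 2 : ℝ)) + 1) * τ) := by
  have hν12 : 0 < ν ^ (-(1 / 2 : ℝ)) := Real.rpow_pos_of_pos hν _
  set J : ℝ := (ν * δ) ^ (-(1 / 2 : ℝ)) + 1 with hJ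
  have hJ0 : 0 ≤ J := by positivity
  -- the two majorants
  set G₁ : ℝ → ℝ≥0∞ := fun σ => (Ioo (τ - δ) τ).indicator
    (fun σ => ENNReal.ofReal (φ τ) * (ENNReal.ofReal (ν ^ (-(1 / 2 : ℝ))) *
      ENNReal.ofReal ((τ - σ) ^ (-(1 / 2 : ℝ))) + 1)) σ with hG₁
  clear_value G₁
  set G₂ : ℝ → ℝ≥0∞ := fun _ => ENNReal.ofReal (φ (τ - δ) * J) with hG₂
  clear_value G₂
  have hpt : ∀ σ ∈ Ioo 0 τ,
      ENNReal.ofReal (φ σ * ((ν * (τ - σ)) ^ (-(1 / 2 : ℝ)) + 1)) ≤ G₁ σ + G₂ σ := by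
    intro σ hσ
    have hts : 0 < τ - σ := sub_pos.2 hσ.2
    have hk : (ν * (τ - σ)) ^ (-(1 / 2 : ℝ)) = ν ^ (-(1 / 2 : ℝ)) * (τ - σ) ^ (-(1 / 2 : ℝ)) :=
      Real.mul_rpow hν.le hts.le
    rcases lt_or_ge (τ - δ) σ with hlate | hearly
    · -- late times: `φ σ ≤ φ τ`
      have hmem : σ ∈ Ioo (τ - δ) τ := ⟨hlate, hσ.2⟩
      have h1 : ENNReal.ofReal (φ σ * ((ν * (τ - σ)) ^ (-(1 / 2 : ℝ)) + 1)) ≤ G₁ σ := by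
        rw [hG₁]; dsimp only
        rw [indicator_of_mem hmem, hk, ← ENNReal.ofReal_one, ← ENNReal.ofReal_mul hν12.le,
          ← ENNReal.ofReal_add (by positivity) zero_le_one, ← ENNReal.ofReal_mul (hφ0 τ)]
        refine ENNReal.ofReal_le_ofReal (mul_le_mul_of_nonneg_right (hφm hσ.2.le) (by positivity))
      exact h1.trans le_self_add
    · -- early times: `φ σ ≤ φ (τ - δ)` and the kernel is at most `J`
      have hφ : φ σ ≤ φ (τ - δ) := hφm hearly
      have hker : (ν * (τ - σ)) ^ (-(1 / 2 : ℝ)) ≤ (ν * δ) ^ (-(1 / 2 : ℝ)) := by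
        have hle : ν * δ ≤ ν * (τ - σ) := mul_le_mul_of_nonneg_left (by linarith) hν.le
        exact Real.rpow_le_rpow_of_nonpos (by positivity) hle (by norm_num)
      have h1 : ENNReal.ofReal (φ σ * ((ν * (τ - σ)) ^ (-(1 / 2 : ℝ)) + 1)) ≤ G₂ σ := by
        rw [hG₂]
        refine ENNReal.ofReal_le_ofReal ?_
        have : (ν * (τ - σ)) ^ (-(1 / 2 : ℝ)) + 1 ≤ J := by rw [hJ]; linarith
        exact mul_le_mul hφ this (by positivity) (hφ0 _)
      exact h1.trans le_add_self
  -- integrate the majorants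
  have hI₁ : ∫⁻ σ in Ioo 0 τ, G₁ σ ≤
      ENNReal.ofReal (φ τ * (2 * ν ^ (-(1 / 2 : ℝ)) * Real.sqrt δ + δ)) := by
    have hmeas : Measurable fun σ : ℝ => ENNReal.ofReal (ν ^ (-(1 / 2 : ℝ))) *
        ENNReal.ofReal ((τ - σ) ^ (-(1 / 2 : ℝ))) :=
      ((measurable_const.sub measurable_id).pow_const _).ennreal_ofReal.const_mul _
    calc ∫⁻ σ in Ioo 0 τ, G₁ σ ≤ ∫⁻ σ, G₁ σ := setLIntegral_le_lintegral _ _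
      _ = ∫⁻ σ in Ioo (τ - δ) τ, ENNReal.ofReal (φ τ) * (ENNReal.ofReal (ν ^ (-(1 / 2 : ℝ))) *
            ENNReal.ofReal ((τ - σ) ^ (-(1 / 2 : ℝ))) + 1) := by
          rw [hG₁]; exact lintegral_indicator measurableSet_Ioo _
      _ = ENNReal.ofReal (φ τ) * ((ENNReal.ofReal (ν ^ (-(1 / 2 : ℝ))) *
            ∫⁻ σ in Ioo (τ - δ) τ, ENNReal.ofReal ((τ - σ) ^ (-(1 / 2 : ℝ)))) +
              volume (Ioo (τ - δ) τ)) := by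
          rw [lintegral_const_mul' _ _ ENNReal.ofReal_ne_top, lintegral_add_left' hmeas.aemeasurable,
            lintegral_const_mul' _ _ ENNReal.ofReal_ne_top, setLIntegral_one]
      _ = ENNReal.ofReal (φ τ * (2 * ν ^ (-(1 / 2 : ℝ)) * Real.sqrt δ + δ)) := by
          rw [setLIntegral_Ioo_sub_rpow_neg_half_of_lt (by linarith : τ - δ < τ), sub_sub_cancel,
            Real.volume_Ioo, sub_sub_cancel, ← ENNReal.ofReal_mul hν12.le,
            ← ENNReal.ofReal_add (by positivity) hδ.le, ← ENNReal.ofReal_mul (hφ0 τ)]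
          congr 1; ring
  have hφJ : 0 ≤ φ (τ - δ) * J := mul_nonneg (hφ0 _) hJ0
  have hI₂ : ∫⁻ σ in Ioo 0 τ, G₂ σ = ENNReal.ofReal (φ (τ - δ) * J * τ) := by
    rw [hG₂]; dsimp only
    rw [setLIntegral_const, Real.volume_Ioo, sub_zero, ← ENNReal.ofReal_mul hφJ]
  have hG₂m : Measurable G₂ := by rw [hG₂]; exact measurable_const
  have hX₁ : 0 ≤ φ τ * (2 * ν ^ (-(1 / 2 : ℝ)) * Real.sqrt δ + δ) := mul_nonneg (hφ0 τ) (by positivity)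
  have hX₂ : 0 ≤ φ (τ - δ) * J * τ := mul_nonneg hφJ hτ
  calc ∫⁻ σ in Ioo 0 τ, ENNReal.ofReal (φ σ * ((ν * (τ - σ)) ^ (-(1 / 2 : ℝ)) + 1))
      ≤ ∫⁻ σ in Ioo 0 τ, (G₁ σ + G₂ σ) := setLIntegral_mono' measurableSet_Ioo hpt
    _ = (∫⁻ σ in Ioo 0 τ, G₁ σ) + ∫⁻ σ in Ioo 0 τ, G₂ σ := lintegral_add_right _ hG₂m
    _ ≤ ENNReal.ofReal (φ τ * (2 * ν ^ (-(1 / 2 : ℝ)) * Real.sqrt δ + δ)) +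
          ENNReal.ofReal (φ (τ - δ) * J * τ) := add_le_add hI₁ hI₂.le
    _ = ENNReal.ofReal (φ τ * (2 * ν ^ (-(1 / 2 : ℝ)) * Real.sqrt δ + δ) +
          φ (τ - δ) * J * τ) := (ENNReal.ofReal_add hX₁ hX₂).symm

/-- **Weighted bound of one Duhamel term, real form with the split Volterra integral.**
Under the hypotheses of `decay_weighted_oseenDuhamel_le_lintegral` with `φ` monotone, for every
`δ > 0` and `τ > 0`:
`w_R(x) ‖B^ν_0(a,b)(τ)(x)‖ ≤ C₀ C_K L (φ(τ)(2ν^{-1/2}√δ + δ) + φ(τ-δ)((νδ)^{-1/2} + 1) τ)`. -/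
theorem decay_weighted_oseenDuhamel_le :
    ∀ {C₀ C_K : ℝ} (hC₀ : 0 < C₀) (hC_K : 0 < C_K)
    (hK : ∀ ⦃σ : ℝ⦄, 0 < σ → ∀ z a b : EuclideanSpace ℝ (Fin 3),
      ‖Literature.Analysis.FluidPDE.oseenKernel σ z a b‖ ≤ C₀ * (σ + ‖z‖ ^ 2) ^ (-(2 : ℝ)) * ‖a‖ * ‖b‖)
    (hW : ∀ ⦃R : ℝ⦄, 1 ≤ R → ∀ ⦃s : ℝ⦄, 0 < s → ∀ x : EuclideanSpace ℝ (Fin 3),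
      ∫⁻ y, ENNReal.ofReal ((s + ‖x - y‖ ^ 2) ^ (-(2 : ℝ)) *
          ((min (1 + ‖x‖) R) ^ 3 / (min (1 + ‖y‖) R) ^ 3)) ≤
        ENNReal.ofReal (C_K * (s ^ (-(1 / 2 : ℝ)) + 1)))
    {ν : ℝ} (hν : 0 < ν) {R : ℝ} (hR : 1 ≤ R)
    {a b : ℝ → EuclideanSpace ℝ (Fin 3) → EuclideanSpace ℝ (Fin 3)} {τ L : ℝ} (hτ : 0 < τ)
    (hL : 0 ≤ L) (φ : ℝ → ℝ) (hφ0 : ∀ σ, 0 ≤ φ σ) (hφm : Monotone φ)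
    (hab : ∀ σ ∈ Set.Ioo 0 τ, ∀ y, (min (1 + ‖y‖) R) ^ 3 * (‖a σ y‖ * ‖b σ y‖) ≤ L * φ σ)
    {δ : ℝ} (hδ : 0 < δ) (x : EuclideanSpace ℝ (Fin 3)),
    (min (1 + ‖x‖) R) ^ 3 * ‖Literature.Analysis.FluidPDE.oseenDuhamel ν 0 a b τ x‖ ≤
      C₀ * C_K * L * (φ τ * (2 * ν ^ (-(1 / 2 : ℝ)) * Real.sqrt δ + δ) +
        φ (τ - δ) * ((ν * δ) ^ (-(1 / 2 : ℝ)) + 1) * τ) := by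
  intro C₀ C_K hC₀ hC_K hK hW ν hν R hR a b τ L hτ hL φ hφ0 hφm hab δ hδ x
  have h1 := decay_weighted_oseenDuhamel_le_lintegral hC₀ hC_K hK hW hν hR hL φ hφ0 hab x
  have h2 := decay_volterra_split hν φ hφ0 hφm hδ hτ.le
  set Bd : ℝ := φ τ * (2 * ν ^ (-(1 / 2 : ℝ)) * Real.sqrt δ + δ) +
    φ (τ - δ) * ((ν * δ) ^ (-(1 / 2 : ℝ)) + 1) * τ with hBd
  have hν12 : 0 < ν ^ (-(1 / 2 : ℝ)) := Real.rpow_pos_of_pos hν _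
  have hJ0 : 0 ≤ (ν * δ) ^ (-(1 / 2 : ℝ)) + 1 := by positivity
  have hBd0 : 0 ≤ Bd :=
    add_nonneg (mul_nonneg (hφ0 τ) (by positivity)) (mul_nonneg (mul_nonneg (hφ0 _) hJ0) hτ.le)
  have hw0 : 0 ≤ (min (1 + ‖x‖) R) ^ 3 := le_trans zero_le_one (decay_one_le_weight hR x)
  have h3 : ENNReal.ofReal ((min (1 + ‖x‖) R) ^ 3) * ‖oseenDuhamel ν 0 a b τ x‖ₑ ≤
      ENNReal.ofReal (C₀ * C_K * L * Bd) := by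
    refine h1.trans ?_
    rw [ENNReal.ofReal_mul (by positivity : (0 : ℝ) ≤ C₀ * C_K * L)]
    exact mul_le_mul_right h2 _
  have h4 : ENNReal.ofReal ((min (1 + ‖x‖) R) ^ 3 * ‖oseenDuhamel ν 0 a b τ x‖) ≤
      ENNReal.ofReal (C₀ * C_K * L * Bd) := by
    rw [ENNReal.ofReal_mul hw0, ofReal_norm]
    exact h3
  exact (ENNReal.ofReal_le_ofReal_iff (by positivity)).1 h4

end Summit.NavierStokesRegularity.NavierStokesRegularity.Theorems.SlicedKelvinPlanarFluxAPriori

end
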